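import Literature.NumberTheory.Automorphic.IntegralEigenclassControl
import Literature.NumberTheory.Automorphic.TwistedQuotientMatrixCoeffDescent
import HarnessLib

/-!
# An integral eigenclass over a small coefficient ring `k₀` gives a point of the big Hecke
# algebra over a big coefficient ring `O ⊇ k₀`

Topic `NumberTheory/Automorphic`; namespace `Literature.NumberTheory.Automorphic.TwistedQuotient`.
Theorems only; no named fact, no instance, no `sorry`.

`IntegralEigenclassHeckePoint.isHeckePoint_of_intFun_eigenclass` turns an integral Hecke
eigenclass `c ∈ H^q(Γ, M̃)` over a coefficient ring `k` (lattice `M ≅ k^d`, eigenvalues `χ : J → k`,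
content `≤ m₀`) into a `k`-point `IsHeckePoint ι T p δ χ` of the big Hecke algebra of a level
tower with `k`-coefficients.  In [Scholze2015, §V.4] the eigenclass and its finiteness live over
the Noetherian ring `k₀ = 𝒪_{E₀}` (a finite extension of `ℤ_p`) while the Hecke algebra `𝕋` is
formed with `ℤ̄_p`-coefficients; one passes from `k₀` to `O = ℤ̄_p` at the finite levels
`k₀/p^{t'} → O/p^{t'}`.  **`isHeckePoint_of_intFun_eigenclass_descent`** does exactly this: from the
same `k₀`-data it produces the `O`-point `IsHeckePoint ι T p δ (algebraMap ∘ χ)`, provided every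
`a ∈ O` lies in an intermediate `k₀ → k₁ → O` with `k₁` free over `k₀` and `k₁/p^s → O/p^s` split
`k₁`-linearly for all `s` (for `O = ℤ̄_p`: `k₁ = 𝒪_{E₀(a)}`, `PadicUnitBallTower`).

Proof (per torsion level `t' = (q+1)t + m₀`, level `L' = T.level r`): reduce `c` to
`c₀ ∈ H^q(Γ, W_{k₀}^{L/L'})`, `W_{k₀} = Fun(𝒢/L', M/p^{t'})` (eigenclass, annihilator
`⊆ (p^{t'-m₀})` — `IntegralEigenclassHeckePoint`); write `M/p^{t'} ≅ (k₀/p^{t'})^d` and the action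
of `L/L'` by matrices `A₀` (`TwistedQuotientMatrixCoeffDescent.sigma₀`); push `c₀` to
`c ∈ H^q(Γ, W_O^{L/L'})` along `k₀/p^{t'} → O/p^{t'}` (`semimap₀O`; still an eigenclass); the
nilpotent control holds over `O` directly (`IntegralEigenclassControl`), and the annihilator
condition over `O` descends to `k₀` through `k₁` (`mem_span_of_smul_semimap_eq_zero`).

## References

* P. Scholze, *On torsion in the cohomology of locally symmetric varieties*, Ann. of Math. 182
  (2015), §V.4, proofs of Thm. V.4.1 and Cor. V.4.2. [Scholze2015]
* K. S. Brown, *Cohomology of Groups*, GTM 87 (1982), III.1 Example 3. [Brown1982CohomologyGroups]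
-/

noncomputable section

open CategoryTheory Literature.Algebra.Homology Literature.RepresentationTheory.GeneralLinear
open scoped Classical

universe u v

namespace Literature.NumberTheory.Automorphic

namespace TwistedQuotient

open IntegralEigenclass

variable {k₀ O : Type u} [CommRing k₀] [CommRing O] [Algebra k₀ O] {Γ 𝒢 : Type u} [Group Γ]
  [Group 𝒢] (ι : Γ →* 𝒢) (T : LevelTower 𝒢) (p : ℕ) {V : Type u} [AddCommGroup V] [Module k₀ V]
  (π : Representation k₀ 𝒢 V) (L : Subgroup 𝒢) (M : Submodule k₀ V)
  (hM : ∀ l ∈ L, ∀ m ∈ M, π l m ∈ M) {J : Type v} (δ : J → 𝒢) (χ : J → k₀)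

/-- `(algebraMap k₀ O) (p^s) = p^s` and the corresponding ideals. [folklore] -/
theorem idealBig_pow_eq (s : ℕ) :
    idealBig (O := O) ((p : k₀) ^ s) = Ideal.span ({(p : O) ^ s} : Set O) := by
  rw [idealBig, map_pow, map_natCast]

/-- **Descent of an integral eigenclass to a point of the big Hecke algebra over a bigger
coefficient ring.**  Hypotheses as in `isHeckePoint_of_intFun_eigenclass` over `k₀`, plus: `O` a
`k₀`-algebra with totally ordered divisibility in which `p` is a non-zero-divisor, and for every
`a ∈ O` an intermediate ring `k₀ → k₁ → O`, free over `k₀` with `a ∈ k₁` and `k₁/p^s → O/p^s` split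
for all `s`.  Conclusion: `algebraMap ∘ χ` is an `O`-point of `𝕋`.
[cite: Scholze2015, §V.4, proofs of Thm. V.4.1 and Cor. V.4.2] -/
theorem isHeckePoint_of_intFun_eigenclass_descent (htot : ∀ a b : k₀, a ∣ b ∨ b ∣ a)
    (htotO : ∀ a b : O, a ∣ b ∨ b ∣ a) (hregO : IsLeftRegular (p : O))
    (hV : ∀ v : V, (p : k₀) • v = 0 → v = 0) {d : ℕ}
    (e : M ≃ₗ[k₀] (Fin d → k₀)) (hδ : ∀ j, π (δ j) = 1)
    (hfin : ∀ j, (ArithmeticQuotient.doubleCosetQuot L (δ j)).Finite)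
    (hlev : ∀ t' : ℕ, ∃ (r : ℕ) (hle : T.level r ≤ L) (_ : ((T.level r).subgroupOf L).Normal),
      ModTrivialOn π M hM (p ^ t') (T.level r) ∧
      (∀ (j : J) (l : L), ∃ a ∈ T.level r, ∃ b ∈ T.level r,
        (l : 𝒢) * δ j * (l : 𝒢)⁻¹ = a * δ j * b) ∧
      (∀ j, Set.BijOn (Subgroup.quotientMapOfLE hle)
        (ArithmeticQuotient.doubleCosetQuot (T.level r) (δ j))
        (ArithmeticQuotient.doubleCosetQuot L (δ j))) ∧
      (∀ j, (ArithmeticQuotient.doubleCosetQuot (T.level r) (δ j)).Finite))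
    {q : ℕ} (c : groupCohomology (intFun ι L π M) q)
    (heig : ∀ j, (groupCohomology.map (MonoidHom.id Γ) (A := intFun ι L π M) (B := intFun ι L π M)
      (heckeIntHom ι L π M hM (rep_mem_of_eq_one π M (hδ j))) q).hom c = χ j • c)
    {m₀ : ℕ} (hcont : ∀ (u : ℕ) (y : groupCohomology (intFun ι L π M) q),
      (p : k₀) ^ u • c ≠ (p : k₀) ^ (u + m₀) • y)
    (hdesc : ∀ a : O, ∃ (k₁ : Type u) (_ : CommRing k₁) (_ : Algebra k₀ k₁) (_ : Algebra k₁ O)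
      (_ : IsScalarTower k₀ k₁ O) (Mb : Type u) (_ : Module.Basis Mb k₀ k₁) (a₁ : k₁),
      algebraMap k₁ O a₁ = a ∧
      ∀ s : ℕ, ∃ r₀ : (O ⧸ idealBig (O := O) ((p : k₀) ^ s)) →ₗ[k₁]
          (k₁ ⧸ idealOne (k₁ := k₁) ((p : k₀) ^ s)),
        ∀ y : k₁, r₀ (Ideal.Quotient.mk _ (algebraMap k₁ O y)) = Ideal.Quotient.mk _ y) :
    IsHeckePoint ι T (p : O) δ (fun j => algebraMap k₀ O (χ j)) := by
  classical
  refine isHeckePoint_of_nilpotentControl.{u, v, u} (ι := ι) (T := T) (ϖ := (p : O)) (δ := δ)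
    (χ := fun j => algebraMap k₀ O (χ j)) fun t => ?_
  obtain ⟨r, hle, hNorm, hmod, hconj, hbij, hfin'⟩ := hlev ((q + 1) * t + m₀)
  haveI := hNorm
  -- ### over `k₀`: the reduction `c₀` of `c` (Part A)
  let t' := (q + 1) * t + m₀
  let W₀ := modLevelProd ι hle π M hM (p ^ t') hmod
  let c₀ : groupCohomology (hKerRep W₀ 0) q := redMap ι hle π M hM (p ^ t') hmod q c
  have hann₀ : ∀ a : k₀, a • c₀ = 0 → a ∈ Ideal.span {(p : k₀) ^ (t' - m₀)} := by
    intro a ha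
    refine mem_span_pow_of_smul_eq_zero htot (fun h0 => ?_) ha
    have h0' : redMap ι hle π M hM (p ^ t') hmod q ((p : k₀) ^ (t' - m₀) • c) = 0 := by
      rw [map_smul]; exact h0
    obtain ⟨y, hy⟩ := exists_eq_smul_of_redMap_eq_zero ι hle π M hM (p ^ t') hmod
      (pow_smul_injective p M hV t') q _ h0'
    refine hcont (t' - m₀) y ?_
    rw [hy, Nat.cast_pow, Nat.sub_add_cancel (Nat.le_add_left m₀ _)]
  -- ### matrix form over `k₀`
  have hsub : nsmulSubmodule (A := k₀) (N := M) (p ^ t') =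
      Ideal.span {(p : k₀) ^ t'} • (⊤ : Submodule k₀ M) := by
    rw [nsmulSubmodule, Nat.cast_pow]
  let a : k₀ := (p : k₀) ^ t'
  let S₀ := k₀ ⧸ Ideal.span ({a} : Set k₀)
  let eN : ModCoeff M (p ^ t') ≃ₗ[k₀] (Fin d → S₀) :=
    (Submodule.quotEquivOfEq _ _ hsub).trans (quotSMulTopEquivPi e (Ideal.span {(p : k₀) ^ t'}))
  have hσn := modRep_eq_one_of_modTrivialOn π M hM (p ^ t') hmod
  let σq : Representation k₀ (L ⧸ (T.level r).subgroupOf L) (ModCoeff M (p ^ t')) :=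
    quotRep (modRep L (latticeRep L π M hM) (p ^ t')) hσn
  have hsurj : Function.Surjective (algebraMap k₀ S₀) := Ideal.Quotient.mk_surjective
  let σS : Representation S₀ (L ⧸ (T.level r).subgroupOf L) (Fin d → S₀) :=
    { toFun := fun h => ((σq.ofLinearEquiv eN) h).extendScalarsOfSurjective hsurj
      map_one' := LinearMap.ext fun w => by
        rw [LinearMap.extendScalarsOfSurjective_apply, map_one]; rfl
      map_mul' := fun g h => LinearMap.ext fun w => by
        rw [LinearMap.extendScalarsOfSurjective_apply, map_mul]; rfl }
  let A₀ : (L ⧸ (T.level r).subgroupOf L) →* Matrix (Fin d) (Fin d) S₀ := toMatrixHom σS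
  have hA₀ : ∀ (h : L ⧸ (T.level r).subgroupOf L) (w : Fin d → S₀),
      sigma₀ a A₀ h w = eN (σq h (eN.symm w)) := fun h w => by
    change resScalars k₀ (matrixRep (toMatrixHom σS)) h w = _
    rw [resScalars_apply, matrixRep_toMatrixHom]
    rfl
  have heN : ∀ (h : L ⧸ (T.level r).subgroupOf L) (v : ModCoeff M (p ^ t')),
      eN.toLinearMap (σq h v) = sigma₀ a A₀ h (eN.toLinearMap v) := fun h v => by
    rw [LinearEquiv.coe_coe, hA₀, LinearEquiv.symm_apply_apply]
  let c₀q : groupCohomology (hKerRep (oneProdTwist ι hle σq) 0) q := c₀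
  let s₀ := hKerSemimap ι hle σq (sigma₀ a A₀) eN.toLinearMap heN
  have hs₀ := hKerSemimap_equivariant ι hle σq (sigma₀ a A₀) eN.toLinearMap heN
  let c₀m : groupCohomology (hKerRep (oneProdTwist ι hle (sigma₀ a A₀)) 0) q := semimap s₀ hs₀ q c₀q
  -- eigenclass property of `c₀m`
  have heig₀m : ∀ j, groupCohomology.map (MonoidHom.id Γ)
      (φZ (oneProdTwist ι hle (sigma₀ a A₀)) (heckeProdTwistHom ι hle
        (1 : Representation k₀ Γ (Fin d → S₀)) (sigma₀ a A₀) (commute_one _) (hconj j) (hfin' j)) 0)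
      q c₀m = χ j • c₀m := by
    intro j
    have hcomm := fun f => hKerSemimap_φZ_heckePolyTwist ι hle σq (sigma₀ a A₀) eN.toLinearMap heN
      δ hconj hfin' (FreeRing.of j) f
    simp only [heckePolyTwist_of] at hcomm
    have h1 := semimap_map_endo s₀ hs₀ _ _ hcomm q c₀q
    change groupCohomology.map (MonoidHom.id Γ) _ q (semimap s₀ hs₀ q c₀q) = _
    rw [← h1]
    have h2 : groupCohomology.map (MonoidHom.id Γ) (φZ (oneProdTwist ι hle σq)
        (heckeProdTwistHom ι hle (1 : Representation k₀ Γ (ModCoeff M (p ^ t'))) σq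
          (commute_one σq) (hconj j) (hfin' j)) 0) q c₀q = χ j • c₀q := by
      change (groupCohomology.map (MonoidHom.id Γ) (A := hKerRep W₀ 0) (B := hKerRep W₀ 0)
          (φZ W₀ (modHecke ι (hconj j) (hfin' j)) 0) q).hom (redMap ι hle π M hM (p ^ t') hmod q c) =
        χ j • redMap ι hle π M hM (p ^ t') hmod q c
      rw [map_φZ_redMap ι hle π M hM (p ^ t') hmod (hδ j) (hconj j) (hbij j) (hfin j) (hfin' j) q c,
        heig j, map_smul]
    rw [h2, map_smulₛₗ]
    rfl
  -- annihilators of `c₀m`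
  have hann₀m : ∀ x : k₀, x • c₀m = 0 → x ∈ Ideal.span ({(p : k₀) ^ (t' - m₀)} : Set k₀) := by
    intro x hx
    refine hann₀ x ?_
    have hinj := semimap_injective_of_bijective s₀ hs₀
      (hKerSemimap_bijective ι hle σq (sigma₀ a A₀) eN.toLinearMap heN eN.bijective) q
    apply hinj
    rw [map_zero]
    change semimap s₀ hs₀ q (x • c₀q) = 0
    rw [map_smulₛₗ]
    exact hx
  -- ### over `O`
  let WO := oneProdTwist ι hle (sigmaO (O := O) a A₀)
  let cO : groupCohomology (hKerRep WO 0) q := semimap₀O (O := O) ι hle a A₀ q c₀m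
  let S : J → Module.End O (groupCohomology (hKerRep WO 0) q) := fun j =>
    (groupCohomology.map (MonoidHom.id Γ) (A := hKerRep WO 0) (B := hKerRep WO 0)
      (φZ WO (heckeProdTwistHom ι hle (1 : Representation O Γ (Fin d → O ⧸ idealBig (O := O) a))
        (sigmaO (O := O) a A₀) (commute_one _) (hconj j) (hfin' j)) 0) q).hom
  refine ⟨(Finset.range (q + 1)).image (fun b => (b, r, t')), q + 1, (q + 1) * t,
    groupCohomology (hKerRep WO 0) q, inferInstance, inferInstance, S, cO, ?_, ?_,
    fun x hx => mem_span_pow_of_pow_mem_span_pow_mul htotO hregO (Nat.succ_ne_zero q) hx, ?_⟩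
  · -- eigenclass over `O`
    intro j
    have hcomm := fun f => hKerSemimap_φZ_heckePolyTwist ι hle (sigma₀ a A₀) (sigmaO (O := O) a A₀)
      (e₀O a) (he₀O a A₀) δ hconj hfin' (FreeRing.of j) f
    simp only [heckePolyTwist_of] at hcomm
    have h1 := semimap_map_endo _ (hKerSemimap_equivariant ι hle _ _ _ (he₀O (O := O) a A₀)) _ _
      hcomm q c₀m
    change groupCohomology.map (MonoidHom.id Γ) _ q (semimap₀O (O := O) ι hle a A₀ q c₀m) = _
    rw [← h1, heig₀m j, map_smulₛₗ]
  · -- annihilators over `O`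
    intro x hx
    obtain ⟨k₁, _, _, _, _, Mb, bB, a₁, rfl, hret⟩ := hdesc x
    obtain ⟨r₀, hr₀⟩ := hret t'
    have hmem := mem_span_of_smul_semimap_eq_zero ι hle a A₀ r₀ hr₀ bB ((p : k₀) ^ (t' - m₀)) q
      c₀m hann₀m a₁ hx
    -- `a₁ ∈ (p^{t'-m₀}) k₁` ⟹ `algebraMap a₁ ∈ (p^{(q+1)t}) O`
    have ht'm : t' - m₀ = (q + 1) * t := Nat.add_sub_cancel _ _
    rw [Ideal.mem_span_singleton] at hmem ⊢
    obtain ⟨z, hz⟩ := hmem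
    refine ⟨algebraMap k₁ O z, ?_⟩
    rw [hz, map_mul, ← IsScalarTower.algebraMap_apply, map_pow, map_natCast, ht'm]
  · -- nilpotent control over `O`
    intro P hP
    have hI : idealBig (O := O) a = Ideal.span ({(p : O) ^ t'} : Set O) := idealBig_pow_eq p t'
    let eNO : (Fin d → O ⧸ idealBig (O := O) a) ≃ₗ[O] (Fin d → modPow O (p : O) t') :=
      LinearEquiv.piCongrRight fun _ => (Ideal.quotientEquivAlgOfEq O hI).toLinearEquiv
    have hctrl := pow_succ_lift_φZ_heckeProdTwist_eq_zero ι T p r hle (sigmaO (O := O) a A₀) δ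
      hconj hfin' t' eNO q P (fun b hb => hP _
        (Finset.mem_image.2 ⟨b, Finset.mem_range.2 (Nat.lt_succ_of_le hb), rfl⟩))
    change ((FreeAlgebra.lift O S P) ^ (q + 1)) cO = 0
    rw [hctrl]
    rfl

end TwistedQuotient

end Literature.NumberTheory.Automorphic
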